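import Summits.NavierStokesRegularity.FluidComputer.SymmetryPlaneFluxRate
import Literature.Analysis.FluidPDE.TaoClassSymmetry
import Literature.Analysis.FluidPDE.ForcedSymmetryPreservation
import Literature.Analysis.FluidPDE.ClassicalSobolevUniqueness
import HarnessLib

/-!
# Symmetry-plane flux law, IV — from mirror-symmetric DATA: the symmetry persists along the
# Navier–Stokes flow (uniqueness), so the flux law holds on the mirror plane at all later times

HONEST FRAMING (cell `ns-blowup`, lane W, seat `ns-blowup-wind`; human ruling D-0035). WHAT THIS
IS NOT: not a statement about Navier–Stokes blow-up in either direction and not about any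
particular flow: uniqueness bookkeeping (the tree's symmetry-preservation theorems, applied to a
coordinate reflection) composed with the flux law of the companion files. It types the sentence the
lane's memos use — «the initial datum is mirror-symmetric, NS keeps it, hence on the plane
`∂ₜω_z + ∇_h·(u_h ω_z) = ν(Δ_h + ∂²_z)ω_z`» (RESULT-P-WIND-NF §0) — for the tree's well-posed
classes on `ℝ³` (the MODEL flows are `T³`-periodic; the periodic analogue is not typed here).

* `exists_linearIsometryEquiv_eq_reflC` — the coordinate reflection `reflC i` IS a linear isometry
  equivalence of `ℝ³` (packaged as an existence statement; no definition is introduced).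
* `mirror_equivariant_of_datum` — an UNFORCED Tao-class solution on `[0,T]`
  (`ν > 0`) from a mirror-equivariant datum has mirror-equivariant slices at every `t ∈ [0,T]`
  (the tree's `IsTaoSolutionOn.conj_eq_of_datum`: isometry covariance + Prodi–Serrin uniqueness);
  `mirror_equivariant_of_forced` — the same in Tao's FORCED finite-energy
  class with a mirror-equivariant force (`IsClassicalNSSolutionOn.conj_eq_of_forced`).
* `mirror_equivariant_of_hasBoundedSobolevNormsOn`,
  `hasDerivWithinAt_setIntegral_curl_mirrorPlane_of_hasBoundedSobolevNormsOn` — the same with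
  EULER INCLUDED (`ν ≥ 0`, forced, class `L^∞_t H^k_x`; uniqueness by the tree's
  `IsClassicalNSSolutionOn.eq_of_hasBoundedSobolevNormsOn`).
* `hasDerivWithinAt_setIntegral_curl_mirrorPlane_of_datum` — CAPSTONE: for a Tao-class
  solution from a mirror-equivariant datum, at every `t ∈ [0,T]` and every fixed rectangle `R` of the
  mirror plane, `d/dt ∫_R ωᵢ = ν ∫_R ∑ⱼ∂ⱼ∂ⱼωᵢ − ∮_{∂R} ωᵢ (u · n_out)` within `[0,T]`.

All proved; 0 `sorry`; no definitions, no named facts. References: Majda–Bertozzi 2002, §1.2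
Prop. 1.1 (iii), §2.3.3 (2.52)–(2.53) (symmetries are kept by uniqueness); Tao 2013, Cor. 11.4.
-/

noncomputable section

open MeasureTheory Set Function Filter Topology
open scoped BigOperators

namespace Summit.NavierStokesRegularity.FluidComputer.SymmetryPlaneFluxLaw

open Literature.Analysis.FluidPDE

section Isometry

/-- **The coordinate reflection is a linear isometry equivalence** of `ℝ³`: there is
`R : ℝ³ ≃ₗᵢ[ℝ] ℝ³` with `R x = reflC i x` and `R⁻¹ x = reflC i x` for all `x` (an involution
preserving every `|xⱼ|`). Stated as an existence theorem so that no definition is introduced. -/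
theorem exists_linearIsometryEquiv_eq_reflC (i : Fin 3) :
    ∃ R : EuclideanSpace ℝ (Fin 3) ≃ₗᵢ[ℝ] EuclideanSpace ℝ (Fin 3),
      (∀ x, R x = reflC i x) ∧ ∀ x, R.symm x = reflC i x := by
  have hnorm : ∀ x : EuclideanSpace ℝ (Fin 3), ‖reflC i x‖ = ‖x‖ := by
    intro x
    rw [EuclideanSpace.norm_eq, EuclideanSpace.norm_eq]
    congr 1
    refine Finset.sum_congr rfl fun j _ => ?_
    rw [reflC_apply]
    split_ifs <;> simp
  let L : EuclideanSpace ℝ (Fin 3) ≃ₗ[ℝ] EuclideanSpace ℝ (Fin 3) :=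
    { (reflC i : EuclideanSpace ℝ (Fin 3) →L[ℝ] EuclideanSpace ℝ (Fin 3)).toLinearMap with
      invFun := reflC i
      left_inv := reflC_reflC i
      right_inv := reflC_reflC i }
  exact ⟨{ L with norm_map' := hnorm }, fun x => rfl, fun x => rfl⟩

variable {u : EuclideanSpace ℝ (Fin 3) → EuclideanSpace ℝ (Fin 3)} {i : Fin 3}

/-- Bookkeeping: mirror equivariance `u ∘ σᵢ = σᵢ ∘ u` is conjugation invariance
`R (u (R⁻¹ x)) = u x` for any isometry packaging `R` of `σᵢ = reflC i`. -/
theorem conj_eq_iff_mirror {R : EuclideanSpace ℝ (Fin 3) ≃ₗᵢ[ℝ] EuclideanSpace ℝ (Fin 3)}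
    (hR : ∀ x, R x = reflC i x) (hRs : ∀ x, R.symm x = reflC i x) :
    (∀ x, R (u (R.symm x)) = u x) ↔ ∀ x, u (reflC i x) = reflC i (u x) := by
  constructor
  · intro h x
    have hx := h (reflC i x)
    rw [hRs, reflC_reflC, hR] at hx
    exact hx.symm
  · intro h x
    rw [hRs, hR, h, reflC_reflC]

end Isometry

section Persistence

open scoped ContDiff NNReal ENNReal

variable {ν T : ℝ} {u₀ : EuclideanSpace ℝ (Fin 3) → EuclideanSpace ℝ (Fin 3)}
  {f u : ℝ → EuclideanSpace ℝ (Fin 3) → EuclideanSpace ℝ (Fin 3)}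
  {p : ℝ → EuclideanSpace ℝ (Fin 3) → ℝ} {i : Fin 3}

/-- **Mirror symmetry persists (unforced, Tao's class).** A Tao-class solution on `[0,T]`
(`0 < T`, `0 < ν`) from a mirror-equivariant datum, `u₀ (σᵢ x) = σᵢ (u₀ x)`, has mirror-equivariant
slices: `u t (σᵢ x) = σᵢ (u t x)` for every `t ∈ [0,T]` (reflection covariance of the equations +
Prodi–Serrin uniqueness in the class, the tree's `IsTaoSolutionOn.conj_eq_of_datum`). -/
theorem mirror_equivariant_of_datum
    (h : IsTaoSolutionOn T ν u₀ u p) (hν : 0 < ν) (hT : 0 < T)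
    (h0 : ∀ x, u₀ (reflC i x) = reflC i (u₀ x)) :
    ∀ t ∈ Icc 0 T, ∀ x, u t (reflC i x) = reflC i (u t x) := by
  obtain ⟨R, hR, hRs⟩ := exists_linearIsometryEquiv_eq_reflC i
  intro t ht
  exact (conj_eq_iff_mirror hR hRs).1 (h.conj_eq_of_datum R hν hT ((conj_eq_iff_mirror hR hRs).2 h0) t ht)

/-- **Mirror symmetry persists (forced, Tao's general finite-energy class).** Under the hypotheses
of the tree's `IsClassicalNSSolutionOn.conj_eq_of_forced` (`ν > 0`, `0 < T`, force jointly smooth on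
`[0,T] × ℝ³` with `‖f‖_{L^∞_t H¹_x} < ∞`, `H¹` datum, finite energy): if the datum `u 0` and every
force slice `f t` are mirror-equivariant, so is every velocity slice `u t`, `t ∈ [0,T]`. -/
theorem mirror_equivariant_of_forced
    (hν : 0 < ν) (hT : 0 < T)
    (hu : IsClassicalNSSolutionOn (Icc 0 T) ν f u p) (hf : IsSmoothSpaceTimeOn (Icc 0 T) f)
    (hfH1 : ∀ j ≤ 1, ∃ C : ℝ≥0, ∀ t ∈ Icc 0 T, ∫⁻ x, ‖iteratedFDeriv ℝ j (f t) x‖ₑ ^ 2 ≤ C)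
    (h₀ : ∀ j ≤ 1, ∫⁻ x, ‖iteratedFDeriv ℝ j (u 0) x‖ₑ ^ 2 < ⊤)
    (huE : ∃ C : ℝ≥0, ∀ t ∈ Icc 0 T, ∫⁻ x, ‖u t x‖ₑ ^ 2 ≤ C)
    (hfM : ∀ t ∈ Icc 0 T, ∀ x, f t (reflC i x) = reflC i (f t x))
    (h0M : ∀ x, u 0 (reflC i x) = reflC i (u 0 x)) :
    ∀ t ∈ Icc 0 T, ∀ x, u t (reflC i x) = reflC i (u t x) := by
  obtain ⟨R, hR, hRs⟩ := exists_linearIsometryEquiv_eq_reflC i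
  intro t ht
  exact (conj_eq_iff_mirror hR hRs).1 (hu.conj_eq_of_forced R hν hT hf hfH1 h₀ huE
    (fun s hs => (conj_eq_iff_mirror hR hRs).2 (hfM s hs)) ((conj_eq_iff_mirror hR hRs).2 h0M) t ht)

/-- **CAPSTONE: the flux law from mirror-symmetric data (unforced, Tao's class).** Let `(u, p)` be
a Tao-class solution of the Navier–Stokes equations on `[0,T] × ℝ³` (`0 < T`, `0 < ν`) from a
mirror-equivariant datum `u₀ ∘ σᵢ = σᵢ ∘ u₀`. Then for every `t ∈ [0,T]` and every fixed rectangle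
`R = P([a₁,b₁]×[a₂,b₂])` of the mirror plane `{xᵢ = 0}` (chart `P (s,t) = s e_{i+1} + t e_{i+2}`),
the normal-vorticity content `s ↦ ∫_R (curl u s)ᵢ` has within `[0,T]` at `t` the derivative
`ν ∫_R ∑ⱼ∂ⱼ∂ⱼωᵢ − ∮_{∂R} ωᵢ (u · n_out)` (edge term = the four signed edge integrals): apart from
viscous diffusion, the flux through a fixed region of the symmetry plane changes only by transport
across its edge by material points of the invariant plane. -/
theorem hasDerivWithinAt_setIntegral_curl_mirrorPlane_of_datum
    (h : IsTaoSolutionOn T ν u₀ u p) (hν : 0 < ν) (hT : 0 < T)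
    (h0 : ∀ x, u₀ (reflC i x) = reflC i (u₀ x)) {t : ℝ} (ht : t ∈ Icc 0 T)
    {P : ℝ × ℝ → EuclideanSpace ℝ (Fin 3)}
    (hP : ∀ q, P q = q.1 • (stdVec (i + 1) : EuclideanSpace ℝ (Fin 3)) + q.2 • stdVec (i + 2))
    {a b : ℝ × ℝ} (hab : a ≤ b) :
    HasDerivWithinAt (fun s => ∫ q in Icc a b, curl (u s) (P q) i)
      (ν * (∫ q in Icc a b, ∑ j, pderiv j (pderiv j fun y => curl (u t) y i) (P q)) -
        ((((∫ s in a.1..b.1, u t (P (s, b.2)) (i + 2) * curl (u t) (P (s, b.2)) i) -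
            ∫ s in a.1..b.1, u t (P (s, a.2)) (i + 2) * curl (u t) (P (s, a.2)) i) +
          ∫ r in a.2..b.2, u t (P (b.1, r)) (i + 1) * curl (u t) (P (b.1, r)) i) -
        ∫ r in a.2..b.2, u t (P (a.1, r)) (i + 1) * curl (u t) (P (a.1, r)) i)) (Icc 0 T) t := by
  have hsym := mirror_equivariant_of_datum h hν hT h0
  have hcl : Icc 0 T ⊆ closure (interior (Icc 0 T)) := by
    rw [interior_Icc, closure_Ioo hT.ne]
  have key := SymmetryPlaneFluxLaw.hasDerivWithinAt_setIntegral_curl_mirrorPlane h.classical isCompact_Icc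
    (convex_Icc 0 T) (uniqueDiffOn_Icc hT) hcl hsym ht hP hab
  have hf0 : ∫ q in Icc a b, curl ((0 : ℝ → EuclideanSpace ℝ (Fin 3) → EuclideanSpace ℝ (Fin 3)) t)
      (P q) i = 0 := by
    simp
  rw [hf0, add_zero] at key
  exact key

end Persistence

section EulerIncluded

open scoped ContDiff NNReal ENNReal

variable {ν T : ℝ} {f u : ℝ → EuclideanSpace ℝ (Fin 3) → EuclideanSpace ℝ (Fin 3)}
  {p : ℝ → EuclideanSpace ℝ (Fin 3) → ℝ} {i : Fin 3}

/-- **Mirror symmetry persists — Euler included (`ν ≥ 0`, forced, class `L^∞_t H^k_x`).** A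
classical solution of the forced Navier–Stokes / Euler system on `[0,T] × ℝ³` (`0 < T`, `0 ≤ ν`)
with `u ∈ L^∞_t H^k_x` for all `k` (`HasBoundedSobolevNormsOn`), from a mirror-equivariant datum
`u 0 ∘ σᵢ = σᵢ ∘ u 0` under a force with mirror-equivariant slices, has mirror-equivariant velocity
slices at every `t ∈ [0,T]`: the mirror conjugate is a solution of the same system
(`IsClassicalNSSolutionOn.conj_linearIsometryEquiv`, `.congr_force`) in the same class
(`lintegral_iteratedFDeriv_conj_linearIsometryEquiv`) from the same datum, and that class has
uniqueness for `ν ≥ 0` (the tree's `IsClassicalNSSolutionOn.eq_of_hasBoundedSobolevNormsOn`,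
Majda–Bertozzi 2002 Cor. 3.1 energy method). -/
theorem mirror_equivariant_of_hasBoundedSobolevNormsOn
    (hu : IsClassicalNSSolutionOn (Icc 0 T) ν f u p) (hν : 0 ≤ ν) (hT : 0 < T)
    (hB : HasBoundedSobolevNormsOn (Icc 0 T) u)
    (hfM : ∀ t ∈ Icc 0 T, ∀ x, f t (reflC i x) = reflC i (f t x))
    (h0M : ∀ x, u 0 (reflC i x) = reflC i (u 0 x)) :
    ∀ t ∈ Icc 0 T, ∀ x, u t (reflC i x) = reflC i (u t x) := by
  obtain ⟨R, hR, hRs⟩ := exists_linearIsometryEquiv_eq_reflC i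
  have hS : UniqueDiffOn ℝ (Icc 0 T) := uniqueDiffOn_Icc hT
  have hfR : ∀ t ∈ Icc 0 T, ∀ x, R (f t (R.symm x)) = f t x :=
    fun t ht => (conj_eq_iff_mirror hR hRs).2 (hfM t ht)
  -- the conjugate solves the same forced system, in the same class, from the same datum
  have hv : IsClassicalNSSolutionOn (Icc 0 T) ν f (fun s y => R (u s (R.symm y)))
      (fun s y => p s (R.symm y)) :=
    (hu.conj_linearIsometryEquiv R hS).congr_force hfR
  have hBv : HasBoundedSobolevNormsOn (Icc 0 T) (fun s y => R (u s (R.symm y))) := by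
    intro n
    obtain ⟨C, hC⟩ := hB n
    refine ⟨C, fun t ht => ?_⟩
    rw [lintegral_iteratedFDeriv_conj_linearIsometryEquiv R (u t) n]
    exact hC t ht
  have h0 : u 0 = (fun s y => R (u s (R.symm y))) 0 :=
    (funext ((conj_eq_iff_mirror hR hRs).2 h0M)).symm
  intro t ht
  have heq := hu.eq_of_hasBoundedSobolevNormsOn hv hν hT hB hBv h0 ht
  refine (conj_eq_iff_mirror hR hRs).1 fun x => ?_
  exact (congrFun heq x).symm ▸ rfl

/-- **The flux law from mirror-symmetric data — Euler included.** For a classical solution of the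
forced Navier–Stokes / Euler system on `[0,T] × ℝ³` (`0 < T`, `0 ≤ ν`) in the class `L^∞_t H^k_x`
with mirror-equivariant datum and force slices, at every `t ∈ [0,T]` and every fixed rectangle `R`
of the mirror plane `{xᵢ = 0}`:
`d/dt ∫_R ωᵢ = ν ∫_R ∑ⱼ∂ⱼ∂ⱼωᵢ − ∮_{∂R} ωᵢ (u · n_out) + ∫_R (curl f)ᵢ` within `[0,T]`; for EULER
(`ν = 0`) and a curl-free force on the plane this is the statement that the normal flux through a
fixed region of the symmetry plane changes ONLY by transport across its edge by the plane's own
material points. -/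
theorem hasDerivWithinAt_setIntegral_curl_mirrorPlane_of_hasBoundedSobolevNormsOn
    (hu : IsClassicalNSSolutionOn (Icc 0 T) ν f u p) (hν : 0 ≤ ν) (hT : 0 < T)
    (hB : HasBoundedSobolevNormsOn (Icc 0 T) u)
    (hfM : ∀ t ∈ Icc 0 T, ∀ x, f t (reflC i x) = reflC i (f t x))
    (h0M : ∀ x, u 0 (reflC i x) = reflC i (u 0 x)) {t : ℝ} (ht : t ∈ Icc 0 T)
    {P : ℝ × ℝ → EuclideanSpace ℝ (Fin 3)}
    (hP : ∀ q, P q = q.1 • (stdVec (i + 1) : EuclideanSpace ℝ (Fin 3)) + q.2 • stdVec (i + 2))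
    {a b : ℝ × ℝ} (hab : a ≤ b) :
    HasDerivWithinAt (fun s => ∫ q in Icc a b, curl (u s) (P q) i)
      (ν * (∫ q in Icc a b, ∑ j, pderiv j (pderiv j fun y => curl (u t) y i) (P q)) -
        ((((∫ s in a.1..b.1, u t (P (s, b.2)) (i + 2) * curl (u t) (P (s, b.2)) i) -
            ∫ s in a.1..b.1, u t (P (s, a.2)) (i + 2) * curl (u t) (P (s, a.2)) i) +
          ∫ r in a.2..b.2, u t (P (b.1, r)) (i + 1) * curl (u t) (P (b.1, r)) i) -
        ∫ r in a.2..b.2, u t (P (a.1, r)) (i + 1) * curl (u t) (P (a.1, r)) i) +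
      ∫ q in Icc a b, curl (f t) (P q) i) (Icc 0 T) t := by
  have hsym := mirror_equivariant_of_hasBoundedSobolevNormsOn hu hν hT hB hfM h0M
  have hcl : Icc 0 T ⊆ closure (interior (Icc 0 T)) := by
    rw [interior_Icc, closure_Ioo hT.ne]
  exact SymmetryPlaneFluxLaw.hasDerivWithinAt_setIntegral_curl_mirrorPlane hu isCompact_Icc
    (convex_Icc 0 T) (uniqueDiffOn_Icc hT) hcl hsym ht hP hab

end EulerIncluded

end Summit.NavierStokesRegularity.FluidComputer.SymmetryPlaneFluxLaw
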